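import Summits.KontsevichZagierPeriods.Zeta5Search.LaiSweepShard

/-!
# `κ₃` sweep certificate — shard file 085 of 127 (shards 595–601 of 889)

HONEST FRAMING. Systematic search; no irrationality claim unless certified. This file only checks,
by `decide +kernel`, shards 595–601 of the order-cell sweep of the `κ₃` point `(74, 2180, 444; δ74)`
(engine `LaiSweepEngine`, soundness `LaiSweepJump/Free/Eval/Shard/Kappa3`; a shard is `⟨regime, n,
p, q, p', q', Lo, Up⟩`: `n` cells from `p/q` to `p'/q'` with integer rate sums in `[Lo, Up]`, `K =
128`, `D = 2^40`). It draws NO conclusion: only the capstone `LaiKappa3SweepCert`, which needs all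
127 shard files, does. Kernel cost of this file ≈ 560 cells × 0.3 s.
-/

namespace Summit.KontsevichZagierPeriods.Zeta5Search.Sweep

set_option maxHeartbeats 100000000 in
/-- Shard 595: 80 cells of regime B from `157/249` to `151/239`.
[cite: Lai2024BallRivoal, §4 Lemma 4.3] -/
theorem shard595 :
    Shard.check 128 (2^40)
      ⟨true, 80, 157, 249, 151, 239, 13048174091755, 17623177512040⟩ = true := by
  decide +kernel

set_option maxHeartbeats 100000000 in
/-- Shard 596: 80 cells of regime B from `151/239` to `226/357`.
[cite: Lai2024BallRivoal, §4 Lemma 4.3] -/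
theorem shard596 :
    Shard.check 128 (2^40)
      ⟨true, 80, 151, 239, 226, 357, 12797198945332, 17301939626330⟩ = true := by
  decide +kernel

set_option maxHeartbeats 100000000 in
/-- Shard 597: 80 cells of regime B from `226/357` to `111/175`.
[cite: Lai2024BallRivoal, §4 Lemma 4.3] -/
theorem shard597 :
    Shard.check 128 (2^40)
      ⟨true, 80, 226, 357, 111, 175, 12557876388843, 16995782986617⟩ = true := by
  decide +kernel

set_option maxHeartbeats 100000000 in
/-- Shard 598: 80 cells of regime B from `111/175` to `279/439`.
[cite: Lai2024BallRivoal, §4 Lemma 4.3] -/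
theorem shard598 :
    Shard.check 128 (2^40)
      ⟨true, 80, 111, 175, 279, 439, 12717895583699, 17229768069490⟩ = true := by
  decide +kernel

set_option maxHeartbeats 100000000 in
/-- Shard 599: 80 cells of regime B from `279/439` to `121/190`.
[cite: Lai2024BallRivoal, §4 Lemma 4.3] -/
theorem shard599 :
    Shard.check 128 (2^40)
      ⟨true, 80, 279, 439, 121, 190, 13279268231538, 18009849563487⟩ = true := by
  decide +kernel

set_option maxHeartbeats 100000000 in
/-- Shard 600: 80 cells of regime B from `121/190` to `275/431`.
[cite: Lai2024BallRivoal, §4 Lemma 4.3] -/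
theorem shard600 :
    Shard.check 128 (2^40)
      ⟨true, 80, 121, 190, 275, 431, 12272103481272, 16660432489211⟩ = true := by
  decide +kernel

set_option maxHeartbeats 100000000 in
/-- Shard 601: 80 cells of regime B from `275/431` to `218/341`.
[cite: Lai2024BallRivoal, §4 Lemma 4.3] -/
theorem shard601 :
    Shard.check 128 (2^40)
      ⟨true, 80, 275, 431, 218, 341, 12625826258362, 17157968547701⟩ = true := by
  decide +kernel

/-- The checked shards of this file, in order. [folklore] -/
def shards085 : List (CheckedShard 128 (2^40)) :=
  [⟨_, shard595⟩, ⟨_, shard596⟩, ⟨_, shard597⟩, ⟨_, shard598⟩, ⟨_, shard599⟩,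
    ⟨_, shard600⟩, ⟨_, shard601⟩]

end Summit.KontsevichZagierPeriods.Zeta5Search.Sweep
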